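import Literature.Geometry.Kaehler.DolbeaultChartAcyclic
import Literature.Geometry.Kaehler.ChartTransport
import Literature.Geometry.Kaehler.PluriharmonicLog
import HarnessLib

/-!
# The local `i∂∂̄`-lemma: a closed real `(1,1)`-form is `(1/2iπ) ∂∂̄ φ` on chart-convex sets

Layer `Literature/Geometry/Kaehler`; support for the heart of Lefschetz's theorem on
`(1,1)`-classes (`Literature.AlgebraicGeometry.HodgeTheory.lefschetzOneOne_rational`, predicate
`ComplexDeRhamIsoFamily.IsLefschetzOneOne`): the LOCAL POTENTIALS of the printed construction of
the Hermitian holomorphic line bundle with a given closed real integral `(1,1)`-form as Chern form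
(Voisin I, §3.3.1 read backwards, Thm. 7.10; Griffiths–Harris, pp. 148–149: "we can find an open
cover `{U_α}` and real functions `φ_α` with `ω = i∂∂̄ φ_α` on `U_α`": a closed real `(1,1)`-form is
locally `i∂∂̄` of a real function, by the Poincaré lemma and the `∂̄`-Poincaré lemma).

Main result, PROVED, in the tree's spelling of `(1/2iπ) ∂∂̄ φ = (1/4π) d((dφ) ∘ J)` for real `φ`
(module docstring of `HolomorphicLineBundle`; `localChernForm`):

* `exists_potential_of_isOfType_one_one` — on the chart set `W = chartSet 𝓘(ℝ, E) p C` of an open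
  convex `C` (a member or finite intersection of a chart-convex cover), every complex `2`-form `ω`
  which is smooth and closed at the points of `W`, of type `(1,1)` and real (`ω̄ = ω` on `W`), is
  `(1/4π) d((dφ) ∘ J)` on `W` for a real function `φ : M → ℝ`, `C^∞` at the points of `W`.

Proof (Griffiths–Harris p. 149): `ω = dα` on `W` with `α` a REAL `1`-form (Poincaré lemma on the
chart-convex `W`, `localClosedForms_chartSet_le_localExactForms`, then symmetrise with `ᾱ`);
`α = α^{1,0} + α^{0,1}` and `∂̄ α^{0,1} = (dα^{0,1})^{0,2} = (dα)^{0,2} − (dα^{1,0})^{0,2} = ω^{0,2} − 0 = 0`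
(`d` of a `(1,0)`-form has no `(0,2)`-part: integrability `d = ∂ + ∂̄`,
`mextDeriv_eq_dolbeault_add_dolbeaultBar_holds`); the chart set is `∂̄`-acyclic
(`isDolbeaultAcyclic_chartSet`, the `∂̄`-Poincaré lemma on convex opens), so `α^{0,1} = ∂̄u` for
a complex function `u = a + ib`; comparing with `θ^{0,1} = ½(θ + iθ∘J)` for `1`-forms and taking
real parts (`α` is real), `α = da − (db) ∘ J` on `W`; hence `ω = dα = −d((db) ∘ J)` (`dd = 0`),
i.e. `ω = (1/4π) d((dφ) ∘ J)` with `φ = −4π b`.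

On the way (all proved): the types of `θ ± i θ∘J` and the explicit `(0,1)`-part of a `1`-form
(`typeComponent_zero_one_eq`), smoothness of conjugates at a point, the vanishing of
`(dγ)^{0,2}` for a smooth `(1,0)`-form `γ` (`typeComponent_zero_two_mextDeriv_eq_zero`), and the
passage from smooth `0`-forms to `C^∞` functions.

## References

* P. Griffiths, J. Harris, *Principles of Algebraic Geometry* (1978), pp. 148–149 (proof of the
  Lefschetz theorem on `(1,1)`-classes: local potentials, transition functions), p. 25
  (`∂̄`-Poincaré lemma).
* C. Voisin, *Hodge Theory and Complex Algebraic Geometry I* (CUP 2002), §2.3.1–2.3.3 (types,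
  `d = ∂ + ∂̄`), Prop. 2.36 (`∂̄`-Poincaré), §3.3.1 (Chern form `(1/2iπ) ∂∂̄ log h`).
-/

noncomputable section

open scoped Manifold ContDiff Topology
open Bundle Set Filter Function Literature.NumberTheory.Transcendental

namespace Literature.Geometry.Kaehler

/-! ### `1`-forms: evaluation, the types of `θ ± i θ∘J`, the explicit `(0,1)`-part -/

section OneForms

variable {E : Type*} [NormedAddCommGroup E] [NormedSpace ℂ E]
  {M : Type*} [TopologicalSpace M] [ChartedSpace E M]

/-- The continuous linear map underlying a `Fin 1`-alternating map (`Λ¹ = dual`). [folklore] -/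
def camOne {T : Type*} [AddCommGroup T] [Module ℝ T] [TopologicalSpace T]
    (f : T [⋀^Fin 1]→L[ℝ] ℂ) : T →L[ℝ] ℂ :=
  (ContinuousAlternatingMap.ofSubsingleton ℝ T ℂ (0 : Fin 1)).symm f

/-- A `Fin 1`-alternating map evaluated on `v` is its linear map on `v 0`. [folklore] -/
theorem cam_apply_eq_camOne {T : Type*} [AddCommGroup T] [Module ℝ T] [TopologicalSpace T]
    (f : T [⋀^Fin 1]→L[ℝ] ℂ) (v : Fin 1 → T) : f v = camOne f (v 0) := by
  conv_lhs => rw [← (ContinuousAlternatingMap.ofSubsingleton ℝ T ℂ (0 : Fin 1)).apply_symm_apply f]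
  rw [ContinuousAlternatingMap.ofSubsingleton_apply_apply]
  rfl

/-- **`θ + i θ∘J` has type `(0,1)`** (for a `1`-form `θ`): under the rotation `e^{it}` of the
tangent space it acquires the factor `e^{-it}`. Voisin I, §2.3.1 (`Ω^{0,1}`: forms `ℂ`-antilinear
in `J`). [cite: VoisinHodgeI2002, §2.3.1] -/
theorem isOfType_zero_one_add_I_smul_compJ (θ : MForm 𝓘(ℝ, E) M ℂ 1) :
    IsOfType 0 1 (θ + Complex.I • θ.compJ) := by
  refine ⟨rfl, fun x t v ↦ ?_⟩
  set L := camOne (θ x) with hL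
  have hev : ∀ u : Fin 1 → TangentSpace 𝓘(ℝ, E) x,
      (θ + Complex.I • θ.compJ) x u = L (u 0) + Complex.I * L (tangentJ E x (u 0)) := by
    intro u
    simp only [Pi.add_apply, Pi.smul_apply, ContinuousAlternatingMap.add_apply,
      ContinuousAlternatingMap.smul_apply, MForm.compJ_apply, smul_eq_mul]
    rw [cam_apply_eq_camOne (θ x) u, cam_apply_eq_camOne (θ x) fun i ↦ tangentJ E x (u i)]
  rw [hev, hev]
  simp only [tangentRotate_eq_cos_add_sin_tangentJ, map_add, map_smul, tangentJ_tangentJ, map_neg,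
    Complex.real_smul]
  rw [show ((((0 : ℕ) : ℤ) - ((1 : ℕ) : ℤ) : ℤ) : ℂ) * t * Complex.I = (-t) * Complex.I by
    push_cast; ring, Complex.exp_mul_I]
  simp only [Complex.cos_neg, Complex.sin_neg, ← Complex.ofReal_cos, ← Complex.ofReal_sin]
  have hI : Complex.I * Complex.I = -1 := Complex.I_mul_I
  linear_combination (Real.sin t * L ((tangentJ E x) (v 0)) : ℂ) * hI

/-- **`θ − i θ∘J` has type `(1,0)`** (for a `1`-form `θ`). Voisin I, §2.3.1 (`Ω^{1,0}`: forms
`ℂ`-linear in `J`). [cite: VoisinHodgeI2002, §2.3.1] -/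
theorem isOfType_one_zero_sub_I_smul_compJ (θ : MForm 𝓘(ℝ, E) M ℂ 1) :
    IsOfType 1 0 (θ - Complex.I • θ.compJ) := by
  refine ⟨rfl, fun x t v ↦ ?_⟩
  set L := camOne (θ x) with hL
  have hev : ∀ u : Fin 1 → TangentSpace 𝓘(ℝ, E) x,
      (θ - Complex.I • θ.compJ) x u = L (u 0) - Complex.I * L (tangentJ E x (u 0)) := by
    intro u
    simp only [Pi.sub_apply, Pi.smul_apply, ContinuousAlternatingMap.sub_apply,
      ContinuousAlternatingMap.smul_apply, MForm.compJ_apply, smul_eq_mul]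
    rw [cam_apply_eq_camOne (θ x) u, cam_apply_eq_camOne (θ x) fun i ↦ tangentJ E x (u i)]
  rw [hev, hev]
  simp only [tangentRotate_eq_cos_add_sin_tangentJ, map_add, map_smul, tangentJ_tangentJ, map_neg,
    Complex.real_smul]
  rw [show ((((1 : ℕ) : ℤ) - ((0 : ℕ) : ℤ) : ℤ) : ℂ) * t * Complex.I = t * Complex.I by
    push_cast; ring, Complex.exp_mul_I]
  simp only [← Complex.ofReal_cos, ← Complex.ofReal_sin]
  have hI : Complex.I * Complex.I = -1 := Complex.I_mul_I
  linear_combination (Real.sin t * L ((tangentJ E x) (v 0)) : ℂ) * hI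

/-- **The `(0,1)`-part of a `1`-form**: `θ^{0,1} = ½ (θ + i θ∘J)` (and `θ^{1,0} = ½ (θ − i θ∘J)`):
`θ` is the sum of these two pieces, of types `(1,0)` and `(0,1)`, and the type projection keeps the
second and kills the first. Voisin I, §2.3.1. [cite: VoisinHodgeI2002, §2.3.1] -/
theorem typeComponent_zero_one_eq (θ : MForm 𝓘(ℝ, E) M ℂ 1) :
    θ.typeComponent 0 1 = (1 / 2 : ℂ) • (θ + Complex.I • θ.compJ) := by
  have hdec : θ = (1 / 2 : ℂ) • (θ - Complex.I • θ.compJ) + (1 / 2 : ℂ) • (θ + Complex.I • θ.compJ) := by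
    rw [← smul_add, sub_add_add_cancel, ← two_smul ℂ θ, smul_smul]
    norm_num
  conv_lhs => rw [hdec]
  rw [MForm.typeComponent_add, MForm.typeComponent_smul, MForm.typeComponent_smul,
    IsOfType.typeComponent_of_ne_holds (isOfType_one_zero_sub_I_smul_compJ θ) (Or.inl one_ne_zero),
    (isOfType_zero_one_add_I_smul_compJ θ).typeComponent_eq_self, smul_zero, zero_add]

/-- `compJ` commutes with real scalars. [folklore] -/
theorem MForm.compJ_smul (c : ℝ) (α : MForm 𝓘(ℝ, E) M ℂ 1) : (c • α).compJ = c • α.compJ := by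
  funext x
  ext v
  rfl

/-- `compJ` is compatible with subtraction. [folklore] -/
theorem MForm.compJ_sub (α β : MForm 𝓘(ℝ, E) M ℂ 1) : (α - β).compJ = α.compJ - β.compJ := by
  funext x
  ext v
  rfl

end OneForms

/-! ### Smoothness: conjugates, complex scalars, `0`-forms versus functions, localisation -/

section Smoothness

variable {E : Type*} [NormedAddCommGroup E] [NormedSpace ℂ E]
  {M : Type*} [TopologicalSpace M] [ChartedSpace E M] {k : ℕ}

/-- The conjugate of a form smooth at `x` is smooth at `x` (pointwise form of `isSmoothForm_conj`).
[folklore] -/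
theorem MForm.SmoothAt.conj {α : MForm 𝓘(ℝ, E) M ℂ k} {x : M} (h : α.SmoothAt x) :
    α.conj.SmoothAt x := by
  rw [MForm.SmoothAt, MForm.inChart_conj]
  exact ((ContinuousLinearMap.compContinuousAlternatingMapCLM ℝ E ℂ ℂ (Fin k)
    (Complex.conjCLE : ℂ →L[ℝ] ℂ)).contDiff.of_le le_top).comp_contDiffWithinAt h

/-- Complex scalars preserve smoothness at a point. [folklore] -/
theorem MForm.SmoothAt.csmul (c : ℂ) {α : MForm 𝓘(ℝ, E) M ℂ k} {x : M} (h : α.SmoothAt x) :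
    (c • α).SmoothAt x := by
  rw [MForm.SmoothAt, MForm.inChart_smul_complex]
  exact ContDiffWithinAt.const_smul c h

/-- **A smooth `0`-form is a `C^∞` function** (converse of `MForm.smoothAt_ofFun_of_contMDiffAt`).
[cite: WarnerGTM94, 2.15] -/
theorem contMDiffAt_of_smoothAt_ofFun {F : Type*} [NormedAddCommGroup F] [NormedSpace ℝ F]
    {f : M → F} {x : M} (h : (MForm.ofFun 𝓘(ℝ, E) f).SmoothAt x) :
    ContMDiffAt 𝓘(ℝ, E) 𝓘(ℝ, F) ∞ f x := by
  rw [MForm.smoothAt_ofFun_iff] at h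
  simp only [ModelWithCorners.Boundaryless.range_eq_univ] at h
  have hc : ContinuousAt f x := by
    have h1 : ContinuousAt (f ∘ (extChartAt 𝓘(ℝ, E) x).symm) (extChartAt 𝓘(ℝ, E) x x) :=
      h.continuousWithinAt.continuousAt univ_mem
    refine (h1.comp (continuousAt_extChartAt (I := 𝓘(ℝ, E)) x)).congr ?_
    filter_upwards [extChartAt_source_mem_nhds (I := 𝓘(ℝ, E)) x] with z hz
    show f ((extChartAt 𝓘(ℝ, E) x).symm (extChartAt 𝓘(ℝ, E) x z)) = f z
    rw [(extChartAt 𝓘(ℝ, E) x).left_inv hz]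
  rw [contMDiffAt_iff]
  refine ⟨hc, ?_⟩
  simpa only [extChartAt_model_space_eq_id, PartialEquiv.refl_coe, Function.id_comp,
    ModelWithCorners.Boundaryless.range_eq_univ] using h

variable [IsManifold 𝓘(ℝ, E) ∞ M]

/-- **Real and imaginary parts commute with `d` on functions**: `d(Re f)(v) = Re (df(v))` for a
complex function `f`, `C^∞` at `x` (chain rule in the chart at `x`). [folklore] -/
theorem mextDeriv_ofFun_re_apply {f : M → ℂ} {x : M} (hf : ContMDiffAt 𝓘(ℝ, E) 𝓘(ℝ, ℂ) ∞ f x)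
    (v : Fin 1 → TangentSpace 𝓘(ℝ, E) x) :
    mextDeriv (MForm.ofFun 𝓘(ℝ, E) fun z ↦ ((f z).re : ℂ)) x v =
      (((mextDeriv (MForm.ofFun 𝓘(ℝ, E) f) x v).re : ℝ) : ℂ) := by
  have hd : DifferentiableAt ℝ (f ∘ (extChartAt 𝓘(ℝ, E) x).symm) (extChartAt 𝓘(ℝ, E) x x) := by
    have h := (contMDiffAt_iff.1 hf).2
    simp only [extChartAt_model_space_eq_id, PartialEquiv.refl_coe, Function.id_comp,
      ModelWithCorners.Boundaryless.range_eq_univ] at h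
    exact (h.contDiffAt univ_mem).differentiableAt (by simp)
  rw [mextDeriv_ofFun_apply, mextDeriv_ofFun_apply]
  simp only [ModelWithCorners.Boundaryless.range_eq_univ, fderivWithin_univ]
  have hcomp : ((fun z ↦ ((f z).re : ℂ)) ∘ (extChartAt 𝓘(ℝ, E) x).symm) =
      (Complex.ofRealCLM.comp Complex.reCLM) ∘ (f ∘ (extChartAt 𝓘(ℝ, E) x).symm) := rfl
  rw [hcomp, fderiv_comp _ (ContinuousLinearMap.differentiableAt _) hd, ContinuousLinearMap.fderiv]
  rfl

/-- `d(Im f)(v) = Im (df(v))` for a complex function `f`, `C^∞` at `x`. [folklore] -/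
theorem mextDeriv_ofFun_im_apply {f : M → ℂ} {x : M} (hf : ContMDiffAt 𝓘(ℝ, E) 𝓘(ℝ, ℂ) ∞ f x)
    (v : Fin 1 → TangentSpace 𝓘(ℝ, E) x) :
    mextDeriv (MForm.ofFun 𝓘(ℝ, E) fun z ↦ ((f z).im : ℂ)) x v =
      (((mextDeriv (MForm.ofFun 𝓘(ℝ, E) f) x v).im : ℝ) : ℂ) := by
  have hd : DifferentiableAt ℝ (f ∘ (extChartAt 𝓘(ℝ, E) x).symm) (extChartAt 𝓘(ℝ, E) x x) := by
    have h := (contMDiffAt_iff.1 hf).2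
    simp only [extChartAt_model_space_eq_id, PartialEquiv.refl_coe, Function.id_comp,
      ModelWithCorners.Boundaryless.range_eq_univ] at h
    exact (h.contDiffAt univ_mem).differentiableAt (by simp)
  rw [mextDeriv_ofFun_apply, mextDeriv_ofFun_apply]
  simp only [ModelWithCorners.Boundaryless.range_eq_univ, fderivWithin_univ]
  have hcomp : ((fun z ↦ ((f z).im : ℂ)) ∘ (extChartAt 𝓘(ℝ, E) x).symm) =
      (Complex.ofRealCLM.comp Complex.imCLM) ∘ (f ∘ (extChartAt 𝓘(ℝ, E) x).symm) := rfl
  rw [hcomp, fderiv_comp _ (ContinuousLinearMap.differentiableAt _) hd, ContinuousLinearMap.fderiv]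
  rfl

variable [FiniteDimensional ℂ E] [T2Space M]

/-- **Localisation (type-free)**: a form smooth at the points of an open `W` and zero off `W` agrees
near each `x ∈ W` with a GLOBALLY smooth form (`f • α` for a bump `f`, `f = 1` near `x`,
`tsupport f ⊆ W`). [folklore] -/
theorem exists_isSmoothForm_eventuallyEq {W : Set M} (hW : IsOpen W) {α : MForm 𝓘(ℝ, E) M ℂ k}
    (hα : α ∈ smoothFormsOn 𝓘(ℝ, E) ℂ W k) {x : M} (hx : x ∈ W) :
    ∃ β : MForm 𝓘(ℝ, E) M ℂ k, IsSmoothForm β ∧ ∀ᶠ z in 𝓝 x, β z = α z := by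
  obtain ⟨f, -, hf⟩ := (SmoothBumpFunction.nhds_basis_tsupport (I := 𝓘(ℝ, E)) x).mem_iff.1
    (hW.mem_nhds hx)
  refine ⟨(f : M → ℝ) • α, fun z ↦ ?_, ?_⟩
  · by_cases hz : z ∈ W
    · exact (hα.1 z hz).fun_smul f.contMDiff.contMDiffAt
    · have h0 : (f : M → ℝ) =ᶠ[𝓝 z] 0 := notMem_tsupport_iff_eventuallyEq.1 fun h ↦ hz (hf h)
      refine MForm.smoothAt_of_eventuallyEq_zero ?_
      filter_upwards [h0] with w hw
      rw [Pi.smul_apply', hw, Pi.zero_apply, zero_smul]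
  · filter_upwards [f.eventuallyEq_one] with z hz
    rw [Pi.smul_apply', hz, Pi.one_apply, one_smul]

end Smoothness

/-! ### Integrability: `d` of a `(1,0)`-form has no `(0,2)`-part -/

section Integrability

variable {E : Type*} [NormedAddCommGroup E] [NormedSpace ℂ E] [FiniteDimensional ℂ E]
  {M : Type*} [TopologicalSpace M] [ChartedSpace E M] [IsManifold 𝓘(ℂ, E) ω M]
  [IsManifold 𝓘(ℝ, E) ∞ M]

omit [FiniteDimensional ℂ E] in
/-- **`(dγ)^{0,2} = 0` for a smooth `(1,0)`-form `γ`** (integrability of the complex structure: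
`dγ = ∂γ + ∂̄γ` has types `(2,0)` and `(1,1)` only; Voisin I, Prop. 2.31 / §2.3.3,
`mextDeriv_eq_dolbeault_add_dolbeaultBar_holds`). [cite: VoisinHodgeI2002, §2.3.3] -/
theorem typeComponent_zero_two_mextDeriv_eq_zero {γ : MForm 𝓘(ℝ, E) M ℂ 1} (hs : IsSmoothForm γ)
    (hγ : IsOfType 1 0 γ) : (mextDeriv γ).typeComponent 0 2 = 0 := by
  have hd := mextDeriv_eq_dolbeault_add_dolbeaultBar_holds hs
  rw [IsOfType.dolbeault_eq_holds hγ, IsOfType.dolbeaultBar_eq_holds hγ] at hd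
  have h1 := typeComponent_typeComponent_holds (1 + 1) 0 0 2 (mextDeriv γ)
  have h2 := typeComponent_typeComponent_holds 1 (0 + 1) 0 2 (mextDeriv γ)
  rw [if_neg (by omega)] at h1
  rw [if_neg (by omega)] at h2
  have h3 : (mextDeriv γ).typeComponent 0 2 =
      ((mextDeriv γ).typeComponent (1 + 1) 0 +
        (mextDeriv γ).typeComponent 1 (0 + 1)).typeComponent 0 2 :=
    congrArg (fun β ↦ MForm.typeComponent 0 2 β) hd
  rw [h3, MForm.typeComponent_add, h1, h2, add_zero]

omit [FiniteDimensional ℂ E] in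
/-- For an arbitrary smooth `1`-form `α`: `(dα)^{0,2} = (dα^{0,1})^{0,2}` — the `(1,0)`-part of `α`
contributes nothing to the `(0,2)`-part of `dα`. [cite: VoisinHodgeI2002, §2.3.3] -/
theorem typeComponent_zero_two_mextDeriv_eq {α : MForm 𝓘(ℝ, E) M ℂ 1} (hs : IsSmoothForm α) :
    (mextDeriv α).typeComponent 0 2 = (mextDeriv (α.typeComponent 0 1)).typeComponent 0 2 := by
  have hsum : α.typeComponent 0 1 + α.typeComponent 1 0 = α := by
    have h := sum_antidiagonal_typeComponent_holds α
    rw [Finset.Nat.sum_antidiagonal_succ] at h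
    simpa using h
  have h10s : IsSmoothForm (α.typeComponent 1 0) := isSmoothForm_typeComponent_holds 1 0 hs
  have h01s : IsSmoothForm (α.typeComponent 0 1) := isSmoothForm_typeComponent_holds 0 1 hs
  have hd : mextDeriv α = mextDeriv (α.typeComponent 0 1) + mextDeriv (α.typeComponent 1 0) := by
    rw [← mextDeriv_add h01s h10s, hsum]
  conv_lhs => rw [hd]
  rw [MForm.typeComponent_add,
    typeComponent_zero_two_mextDeriv_eq_zero h10s
      (isOfType_typeComponent_holds (k := 1) (p := 1) (q := 0) rfl α), add_zero]

end Integrability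

/-! ### The local `i∂∂̄`-lemma -/

section DDbar

variable {E : Type*} [NormedAddCommGroup E] [NormedSpace ℂ E] [FiniteDimensional ℂ E]
  {M : Type*} [TopologicalSpace M] [ChartedSpace E M] [IsManifold 𝓘(ℂ, E) ω M]
  [IsManifold 𝓘(ℝ, E) ∞ M] [T2Space M]

/-- **The local `i∂∂̄`-lemma on chart-convex sets.** Let `W = chartSet 𝓘(ℝ, E) p C` be the chart
set of an open convex `C` contained in the target of the chart at `p`, and let `ω` be a complex
`2`-form, smooth and closed at the points of `W`, of type `(1,1)`, and real on `W` (`ω̄ = ω`).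
Then there is a real function `φ : M → ℝ`, `C^∞` at the points of `W`, with
`ω = (1/4π) d((dφ) ∘ J)` on `W` (`= (1/2iπ) ∂∂̄ φ`, the normalisation of the Chern form
`(1/2iπ) ∂∂̄ log h` of `HolomorphicLineBundle.HermitianMetric.localChernForm`). Proof in the module
docstring (Poincaré lemma, `∂̄`-Poincaré lemma on the chart-convex `W`, `θ^{0,1} = ½(θ + iθ∘J)`,
real parts). Griffiths–Harris p. 149 ("real functions `φ_α` with `ω = i∂∂̄φ_α` on `U_α`");
Voisin I, §3.3.1 and Prop. 2.36. [cite: GriffithsHarris1978, p. 149]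
[cite: VoisinHodgeI2002, §3.3.1 and Prop. 2.36] -/
theorem exists_potential_of_isOfType_one_one (p : M) {C : Set E} (hC : IsOpen C)
    (hCc : Convex ℝ C) (hCT : C ⊆ (extChartAt 𝓘(ℝ, E) p).target) {Ω : MForm 𝓘(ℝ, E) M ℂ 2}
    (hωs : ∀ x ∈ chartSet 𝓘(ℝ, E) p C, Ω.SmoothAt x)
    (hωc : ∀ x ∈ chartSet 𝓘(ℝ, E) p C, mextDeriv Ω x = 0) (h11 : IsOfType 1 1 Ω)
    (hωr : ∀ x ∈ chartSet 𝓘(ℝ, E) p C, Ω.conj x = Ω x) :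
    ∃ φ : M → ℝ, (∀ x ∈ chartSet 𝓘(ℝ, E) p C, ContMDiffAt 𝓘(ℝ, E) 𝓘(ℝ, ℝ) ∞ φ x) ∧
      ∀ x ∈ chartSet 𝓘(ℝ, E) p C,
        ((1 / (4 * Real.pi)) •
          mextDeriv (mextDeriv (MForm.ofFun 𝓘(ℝ, E) fun z ↦ (φ z : ℂ))).compJ) x = Ω x := by
  set W := chartSet 𝓘(ℝ, E) p C with hW_def
  have hW : IsOpen W := isOpen_chartSet 𝓘(ℝ, E) p hC
  have hCt : C ⊆ (chartAt E p).target := by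
    simpa only [extChartAt_target, modelWithCornersSelf_coe_symm, preimage_id_eq, id_eq,
      ModelWithCorners.Boundaryless.range_eq_univ, inter_univ] using hCT
  ---- Step 1: `Ω = dα₀` on `W` (Poincaré lemma), then a REAL primitive `α = ½(α₀ + ᾱ₀)`
  have hωW : Ω.restr W ∈ localClosedForms 𝓘(ℝ, E) ℂ 2 W :=
    ⟨⟨fun x hx ↦ (MForm.smoothAt_restr_iff hW Ω hx).2 (hωs x hx),
      fun x hx ↦ MForm.restr_apply_of_notMem Ω hx⟩,
      fun x hx ↦ by rw [mextDeriv_restr_apply hW Ω hx]; exact hωc x hx⟩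
  obtain ⟨α₀, hα₀⟩ := (mem_localExactForms_succ_iff hW).1
    (localClosedForms_chartSet_le_localExactForms (I := 𝓘(ℝ, E)) (F := ℂ) (k := 1) p hC hCc hCT
      hωW)
  have hdα₀ : ∀ x ∈ W, mextDeriv (α₀ : MForm 𝓘(ℝ, E) M ℂ 1) x = Ω x := fun x hx ↦ by
    rw [← localD_apply_of_mem hW α₀ hx, hα₀, MForm.restr_apply_of_mem Ω hx]
  set α : MForm 𝓘(ℝ, E) M ℂ 1 :=
    (1 / 2 : ℝ) • ((α₀ : MForm 𝓘(ℝ, E) M ℂ 1) + (α₀ : MForm 𝓘(ℝ, E) M ℂ 1).conj) with hα_def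
  have hαs : ∀ x ∈ W, α.SmoothAt x := fun x hx ↦
    ((α₀.2.1 x hx).add (α₀.2.1 x hx).conj).smul _
  have hα0 : ∀ x ∉ W, α x = 0 := fun x hx ↦ by
    have h0 : (α₀ : MForm 𝓘(ℝ, E) M ℂ 1) x = 0 := α₀.2.2 x hx
    ext v
    simp [hα_def, h0]
  have hαmem : α ∈ smoothFormsOn 𝓘(ℝ, E) ℂ W 1 := ⟨hαs, hα0⟩
  have hαreal : ∀ (x : M) (v : Fin 1 → TangentSpace 𝓘(ℝ, E) x),
      starRingEnd ℂ (α x v) = α x v := fun x v ↦ by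
    simp only [hα_def, Pi.smul_apply, Pi.add_apply, ContinuousAlternatingMap.smul_apply,
      ContinuousAlternatingMap.add_apply, MForm.conj_apply, Complex.real_smul,
      map_mul, map_add, Complex.conj_conj, Complex.conj_ofReal]
    ring
  have hdα : ∀ x ∈ W, mextDeriv α x = Ω x := fun x hx ↦ by
    have hconj : (mextDeriv (α₀ : MForm 𝓘(ℝ, E) M ℂ 1)).conj x = Ω x := by
      rw [← hωr x hx]
      ext v
      rw [MForm.conj_apply, MForm.conj_apply, hdα₀ x hx]
    rw [hα_def, mextDeriv_smul, Pi.smul_apply,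
      mextDeriv_add_apply (α₀.2.1 x hx) (α₀.2.1 x hx).conj, mextDeriv_conj_holds, hdα₀ x hx, hconj,
      ← two_smul ℝ (Ω x), smul_smul]
    norm_num
  ---- Step 2: the `(0,1)`-part `α01 = α^{0,1}|_W ∈ A^{0,1}(W)` is `∂̄_W`-closed
  -- smoothness of the type components of `α` at the points of `W`, by localisation
  have hloc : ∀ x ∈ W, ∃ α' : MForm 𝓘(ℝ, E) M ℂ 1, IsSmoothForm α' ∧ ∀ᶠ z in 𝓝 x, α' z = α z :=
    fun x hx ↦ exists_isSmoothForm_eventuallyEq hW hαmem hx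
  have h01smooth : ∀ x ∈ W, (α.typeComponent 0 1).SmoothAt x := by
    intro x hx
    obtain ⟨α', hα's, hα'⟩ := hloc x hx
    have h1 : (α'.typeComponent 0 1).SmoothAt x := isSmoothForm_typeComponent_holds 0 1 hα's x
    have h2 : ∀ᶠ z in 𝓝 x, α'.typeComponent 0 1 z = α.typeComponent 0 1 z :=
      typeComponent_eventuallyEq 0 1 hα'
    exact h1.congr_of_eventuallyEq h2
  set α01 : ↥(pqFormsOn E M W 0 1) :=
    ⟨(α.typeComponent 0 1).restr W,
      fun x hx ↦ (MForm.smoothAt_restr_iff hW _ hx).2 (h01smooth x hx),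
      fun x hx ↦ MForm.restr_apply_of_notMem _ hx,
      (isOfType_typeComponent_holds (k := 1) (p := 0) (q := 1) rfl α).restr W⟩ with hα01_def
  -- `(d α^{0,1})^{0,2} = 0` at the points of `W`
  have hΩ02 : Ω.typeComponent 0 2 = 0 :=
    IsOfType.typeComponent_of_ne_holds h11 (Or.inl one_ne_zero)
  have hkey : ∀ x ∈ W, (mextDeriv ((α.typeComponent 0 1).restr W)).typeComponent 0 2 x = 0 := by
    intro x hx
    obtain ⟨α', hα's, hα'⟩ := hloc x hx
    -- near `x`: `α^{0,1}|_W = α'^{0,1}`, so their `d` agree near `x`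
    have h1 : ∀ᶠ z in 𝓝 x, (α.typeComponent 0 1).restr W z = α'.typeComponent 0 1 z := by
      filter_upwards [MForm.restr_eventuallyEq hW (α.typeComponent 0 1) hx,
        typeComponent_eventuallyEq 0 1 hα'] with z hz hz'
      rw [hz, hz']
    have h2 : ∀ᶠ z in 𝓝 x, (mextDeriv ((α.typeComponent 0 1).restr W)).typeComponent 0 2 z =
        (mextDeriv (α'.typeComponent 0 1)).typeComponent 0 2 z :=
      typeComponent_eventuallyEq 0 2 (mextDeriv_eventuallyEq_of_eventuallyEq h1)
    -- `dα' = dα = Ω` near `x`, and `Ω^{0,2} = 0`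
    have h3 : ∀ᶠ z in 𝓝 x, mextDeriv α' z = Ω z := by
      filter_upwards [mextDeriv_eventuallyEq_of_eventuallyEq hα', hW.mem_nhds hx] with z hz hzW
      rw [hz, hdα z hzW]
    have h4 : ∀ᶠ z in 𝓝 x, (mextDeriv α').typeComponent 0 2 z = Ω.typeComponent 0 2 z :=
      typeComponent_eventuallyEq 0 2 h3
    have h5 : (mextDeriv α').typeComponent 0 2 =
        (mextDeriv (α'.typeComponent 0 1)).typeComponent 0 2 :=
      typeComponent_zero_two_mextDeriv_eq hα's
    calc (mextDeriv ((α.typeComponent 0 1).restr W)).typeComponent 0 2 x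
        = (mextDeriv (α'.typeComponent 0 1)).typeComponent 0 2 x := h2.self_of_nhds
      _ = (mextDeriv α').typeComponent 0 2 x := by rw [h5]
      _ = Ω.typeComponent 0 2 x := h4.self_of_nhds
      _ = 0 := by rw [hΩ02]; rfl
  have h01type : IsOfType 0 1 ((α.typeComponent 0 1).restr W) :=
    (isOfType_typeComponent_holds (k := 1) (p := 0) (q := 1) rfl α).restr W
  have hdbar01 : ∀ x ∈ W, dolbeaultBar ((α.typeComponent 0 1).restr W) x = 0 := by
    intro x hx
    have h := congrFun (IsOfType.dolbeaultBar_eq_holds h01type) x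
    rw [h]
    exact hkey x hx
  have hclosed : localDbar E M hW 0 1 α01 = 0 := by
    refine Subtype.ext (funext fun x ↦ ?_)
    rw [coe_localDbar, ZeroMemClass.coe_zero, Pi.zero_apply]
    by_cases hx : x ∈ W
    · rw [MForm.restr_apply_of_mem _ hx, hα01_def]
      exact hdbar01 x hx
    · rw [MForm.restr_apply_of_notMem _ hx]
  ---- Step 3: `∂̄`-acyclicity of the chart set: `α^{0,1} = ∂̄ u` on `W`
  obtain ⟨u, hu⟩ := isDolbeaultAcyclic_chartSet p hC hCc hCt 0 0 α01 hclosed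
  have hu' : ∀ x ∈ W, dolbeaultBar (u : MForm 𝓘(ℝ, E) M ℂ (0 + 0)) x =
      (α.typeComponent 0 1) x := by
    intro x hx
    have h := congrArg (fun β : ↥(pqFormsOn E M W 0 (0 + 1)) ↦ (β : MForm 𝓘(ℝ, E) M ℂ (0 + (0 + 1))) x) hu
    rw [localDbar_apply_of_mem hW u hx] at h
    rw [h, hα01_def]
    exact MForm.restr_apply_of_mem _ hx
  -- the function `uf` of the `0`-form `u`, its real and imaginary parts
  set uf : M → ℂ := fun z ↦ (u : MForm 𝓘(ℝ, E) M ℂ (0 + 0)) z 0 with huf_def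
  have hufu : MForm.ofFun 𝓘(ℝ, E) uf = (u : MForm 𝓘(ℝ, E) M ℂ (0 + 0)) := by
    funext z
    ext v
    rw [MForm.ofFun_apply, huf_def]
    exact congrArg _ (funext fun i ↦ Fin.elim0 (i : Fin 0))
  have hufs : ∀ x ∈ W, ContMDiffAt 𝓘(ℝ, E) 𝓘(ℝ, ℂ) ∞ uf x := fun x hx ↦
    contMDiffAt_of_smoothAt_ofFun (by rw [hufu]; exact u.2.1 x hx)
  set aC : M → ℂ := fun z ↦ ((uf z).re : ℂ) with haC_def
  set bC : M → ℂ := fun z ↦ ((uf z).im : ℂ) with hbC_def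
  have haCs : ∀ x ∈ W, ContMDiffAt 𝓘(ℝ, E) 𝓘(ℝ, ℂ) ∞ aC x := fun x hx ↦
    (Complex.ofRealCLM.comp Complex.reCLM).contDiff.comp_contMDiffAt (hufs x hx)
  have hbCs : ∀ x ∈ W, ContMDiffAt 𝓘(ℝ, E) 𝓘(ℝ, ℂ) ∞ bC x := fun x hx ↦
    (Complex.ofRealCLM.comp Complex.imCLM).contDiff.comp_contMDiffAt (hufs x hx)
  -- `∂̄ u = ½ (du + i du∘J)` and `α^{0,1} = ½ (α + i α∘J)`: hence `du + i du∘J = α + i α∘J` on `W`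
  have hu01 : IsOfType 0 0 (u : MForm 𝓘(ℝ, E) M ℂ (0 + 0)) := u.2.2.2
  have hdu : ∀ x ∈ W, (mextDeriv (MForm.ofFun 𝓘(ℝ, E) uf)).typeComponent 0 1 x =
      (α.typeComponent 0 1) x := by
    intro x hx
    have h : dolbeaultBar (u : MForm 𝓘(ℝ, E) M ℂ (0 + 0)) x =
        (mextDeriv (u : MForm 𝓘(ℝ, E) M ℂ (0 + 0))).typeComponent 0 (0 + 1) x :=
      congrFun (IsOfType.dolbeaultBar_eq_holds hu01) x
    have h2 : (mextDeriv (u : MForm 𝓘(ℝ, E) M ℂ (0 + 0))).typeComponent 0 1 x =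
        dolbeaultBar (u : MForm 𝓘(ℝ, E) M ℂ (0 + 0)) x := h.symm
    rw [hufu, h2]
    exact hu' x hx
  have hstar : ∀ x ∈ W, ∀ v : Fin 1 → TangentSpace 𝓘(ℝ, E) x,
      mextDeriv (MForm.ofFun 𝓘(ℝ, E) uf) x v +
          Complex.I * mextDeriv (MForm.ofFun 𝓘(ℝ, E) uf) x (fun i ↦ tangentJ E x (v i)) =
        α x v + Complex.I * α x (fun i ↦ tangentJ E x (v i)) := by
    intro x hx v
    have e1 : (mextDeriv (MForm.ofFun 𝓘(ℝ, E) uf)).typeComponent 0 1 =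
        (1 / 2 : ℂ) • (mextDeriv (MForm.ofFun 𝓘(ℝ, E) uf) +
          Complex.I • (mextDeriv (MForm.ofFun 𝓘(ℝ, E) uf)).compJ) :=
      typeComponent_zero_one_eq _
    have e2 : α.typeComponent 0 1 = (1 / 2 : ℂ) • (α + Complex.I • α.compJ) :=
      typeComponent_zero_one_eq α
    have h := hdu x hx
    rw [e1, e2] at h
    have h' := DFunLike.congr_fun h v
    simp only [Pi.smul_apply, Pi.add_apply, ContinuousAlternatingMap.smul_apply,
      ContinuousAlternatingMap.add_apply, MForm.compJ_apply, smul_eq_mul] at h'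
    have h'' := congrArg (fun z : ℂ ↦ 2 * z) h'
    convert h'' using 1 <;> ring
  ---- Step 4: real parts — `α = d a − (d b) ∘ J` on `W` (`u = a + i b`, `α` real)
  have hR : ∀ x ∈ W, α x = (mextDeriv (MForm.ofFun 𝓘(ℝ, E) aC) -
      (mextDeriv (MForm.ofFun 𝓘(ℝ, E) bC)).compJ) x := by
    intro x hx
    ext v
    rw [Pi.sub_apply, ContinuousAlternatingMap.sub_apply, MForm.compJ_apply,
      mextDeriv_ofFun_re_apply (hufs x hx), mextDeriv_ofFun_im_apply (hufs x hx)]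
    have h := congrArg Complex.re (hstar x hx v)
    have hr1 : (α x v).im = 0 := by
      have h1 := congrArg Complex.im (hαreal x v)
      rw [Complex.conj_im] at h1
      linarith
    have hr2 : (α x (fun i ↦ tangentJ E x (v i))).im = 0 := by
      have h1 := congrArg Complex.im (hαreal x fun i ↦ tangentJ E x (v i))
      rw [Complex.conj_im] at h1
      linarith
    simp only [Complex.add_re, Complex.mul_re, Complex.I_re, Complex.I_im, zero_mul, one_mul,
      zero_sub, hr2, sub_zero] at h
    apply Complex.ext
    · simp only [Complex.sub_re, Complex.ofReal_re]
      linarith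
    · simp only [Complex.sub_im, Complex.ofReal_im, hr1]
      ring
  ---- Step 5: `Ω = dα = −d((db) ∘ J)` on `W`
  have hdaC : ∀ x ∈ W, ∀ᶠ z in 𝓝 x, (MForm.ofFun 𝓘(ℝ, E) aC).SmoothAt z := fun x hx ↦
    Filter.eventually_of_mem (hW.mem_nhds hx) fun z hz ↦
      MForm.smoothAt_ofFun_of_contMDiffAt (haCs z hz)
  have hdbC : ∀ x ∈ W, ∀ᶠ z in 𝓝 x, (MForm.ofFun 𝓘(ℝ, E) bC).SmoothAt z := fun x hx ↦
    Filter.eventually_of_mem (hW.mem_nhds hx) fun z hz ↦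
      MForm.smoothAt_ofFun_of_contMDiffAt (hbCs z hz)
  have hΩeq : ∀ x ∈ W,
      mextDeriv (mextDeriv (MForm.ofFun 𝓘(ℝ, E) bC)).compJ x = -Ω x := by
    intro x hx
    have hev : ∀ᶠ z in 𝓝 x, α z = (mextDeriv (MForm.ofFun 𝓘(ℝ, E) aC) +
        (-1 : ℝ) • (mextDeriv (MForm.ofFun 𝓘(ℝ, E) bC)).compJ) z := by
      filter_upwards [Filter.eventually_of_mem (hW.mem_nhds hx) hR] with z hz
      rw [hz, Pi.sub_apply, Pi.add_apply, Pi.smul_apply, neg_one_smul, sub_eq_add_neg]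
    have h1 : (mextDeriv (MForm.ofFun 𝓘(ℝ, E) aC)).SmoothAt x :=
      MForm.SmoothAt.mextDeriv (hdaC x hx)
    have h2 : ((-1 : ℝ) • (mextDeriv (MForm.ofFun 𝓘(ℝ, E) bC)).compJ).SmoothAt x :=
      ((MForm.SmoothAt.mextDeriv (hdbC x hx)).compJ).smul _
    have h := hdα x hx
    rw [mextDeriv_congr_of_eventuallyEq hev, mextDeriv_add_apply h1 h2,
      mextDeriv_mextDeriv_of_smoothAt (hdaC x hx), zero_add, mextDeriv_smul, Pi.smul_apply,
      neg_one_smul] at h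
    rw [← h, neg_neg]
  ---- Step 6: `φ = −4π b`
  refine ⟨fun z ↦ -(4 * Real.pi) * (uf z).im, fun x hx ↦ ?_, fun x hx ↦ ?_⟩
  · exact (contDiff_const.mul Complex.imCLM.contDiff).comp_contMDiffAt (hufs x hx)
  · have hφ : (MForm.ofFun 𝓘(ℝ, E) fun z ↦ ((-(4 * Real.pi) * (uf z).im : ℝ) : ℂ)) =
        (-(4 * Real.pi)) • MForm.ofFun 𝓘(ℝ, E) bC := by
      funext z
      ext v
      simp only [MForm.ofFun_apply, hbC_def, Pi.smul_apply, ContinuousAlternatingMap.smul_apply,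
        Complex.real_smul, Complex.ofReal_mul, Complex.ofReal_neg, Complex.ofReal_ofNat]
    rw [hφ, mextDeriv_smul, MForm.compJ_smul, mextDeriv_smul, smul_smul, Pi.smul_apply, hΩeq x hx,
      smul_neg, show (1 / (4 * Real.pi)) * (-(4 * Real.pi)) = (-1 : ℝ) by
        field_simp, neg_one_smul, neg_neg]

end DDbar

end Literature.Geometry.Kaehler

end
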